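import Summits.HodgeConjecture.HodgeConjecture.Theorems.Ring2AbelianAllAndreLeraySplitting
import Summits.HodgeConjecture.HodgeConjecture.Theorems.Ring2AbelianAllAndreFibreClassExtremeDegrees
import Literature.AlgebraicGeometry.HodgeTheory.ComplexGysinHodgeType
import HarnessLib

/-!
# Ring 2 · sub-cell AbelianAll (ALL ABELIAN VARIETIES), André axis, part XXXVII-a — THE `θ_N`-WEIGHTS ARE ORTHOGONAL FOR THE
# POINCARÉ PAIRING: `ν^*` acts as `N^{2d}` on `H^{2d+2}(𝒳)`, classes of weights `Nʲ`, `N^{j'}` pair to zero unless `j + j' = 2d`,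
# and the polarisation has an algebraic TOP-WEIGHT representative `η₀` (`ν^* η₀ = N² η₀`, same fibre classes)

HONEST FRAMING (page 1, verbatim): **research route, not a corollary; conditional on HC_CM plus one named
minimal statement.** Cell line: research route conditional on HC_CM; not a corollary; Q11.4-sentence-2
already refuted in dim ≥ 3. Nothing in this file proves a case of the Hodge conjecture for an abelian variety; `HC_CM` does not occur in
this file; item `Theses.RankFourFaces.CMToAbelian` (stmt-16267) OPEN and not closed here. Seat `pub-hodge-ring2-ab-andre-2`, gen 29;
brief (iii) "attack `B_min`: … the auxiliary varieties are not abelian" — part XXXVII derives the MIDDLE relative Lefschetz block (ρ) of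
ring2-b05's `B⋆(𝒳)` assembly (parts XXXVI-e/f left exactly this block displayed) from the fibre square, by weights. This file is the
linear algebra of the weights against Poincaré duality on the total space.

## What is proved (theorems only; no definition, no named fact, no sorry; `HC_CM` absent)

Let `f : 𝒳 ⟶ S` be a compact pencil of abelian `d`-folds, `t` a point, `ν` an `S`-endomorphism charted by `N · 𝟙_A` on the fibres
(parts XXV–XXVI: `ν^*` acts on `H^{k+2}(𝒳)` with the three weights `N^{k+2}, N^{k+1}, Nᵏ` — top / middle / bottom Leray piece).

* §1 `mem_range_complexGysin_top` — `H^{2d+2}(𝒳) = j_{t*} H^{2d}(X_t)` (the top degree is a line and `j_{t*} j_t^*` is non-zero on it, part XI);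
  **`map_top_eq_smul`** — `ν^* ω = N^{2d} · ω` for every `ω ∈ H^{2d+2}(𝒳(ℂ); ℂ)` (the bottom weight of the top degree, (gysFib)).
* §2 **`cupProduct_eq_zero_of_weights`** — WEIGHT ORTHOGONALITY: if `ν^* y = Nʲ y`, `ν^* y' = N^{j'} y'` in complementary degrees
  `k + k' = 2d + 2` and `j + j' ≠ 2d`, then `y ∪ y' = 0` (`ν^*` is a ring homomorphism and acts as `N^{2d}` on the top degree; `N ≥ 2`);
  `cupPairing_eq_zero_of_weights` (the same for `⟨y ∪ y', [𝒳(ℂ)]⟩`); `eq_zero_of_weight_of_forall` — a class of weight `Nʲ` in `H^{k+2}`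
  orthogonal to the classes of weight `N^{2d-j}` in the complementary degree is zero (the partner degree splits into its three weights, part XXXVI-b,
  and the Poincaré pairing is perfect).
* §3 **`exists_topWeight_polarization`** — an ALGEBRAIC, RATIONAL class `η₀ ∈ H²(𝒳(ℂ); ℂ)` of EXACT top weight (`ν^* η₀ = N² η₀`) whose
  restriction to every fibre is the polarisation of part XII (`j_s^* η₀ = j_s^* K`, a polarisation class of `X_s`): `η₀ = e₀ K` for the top Leray
  idempotent of part XXXVI-b (algebraic, rational, `j_t^* e₀ = j_t^*`; the defect `e₀ K − K` dies on `X_t`, hence on every fibre, part X-c);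
  `map_cupProduct_of_weights` — `ν^*(x ∪ y) = N^{a+b} (x ∪ y)` for `ν^* x = Nᵃ x`, `ν^* y = Nᵇ y` (so `L_{η₀}` raises weights by exactly `2`).

## Honest status

Per-pencil linear algebra for a GIVEN fibrewise multiplication (θ∀ stays displayed); no node is born; nothing is minimal; nothing here is
progress on `HC_AV` by itself; N104 untouched. Consumers: parts XXXVII-b…f (selection rules of relative correspondences, the middle block).

References: Kleiman1968AlgebraicCycles (§1.3 p. 374: `[n]^*` weights); DeningerMurre1991 (Thm. 3.1); Kunnemann1993 (Thm. 3.1);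
HatcherAT2002 (§3.3 Prop. 3.38, Thm. 3.26); FultonYoungTableaux1997 (App. B §B.1 (5)–(6)); MumfordAV1970 (§19); Milne2020HodgeClassesAV (proof of Prop. 1).
-/

noncomputable section

set_option linter.dupNamespace false

namespace Summit.HodgeConjecture.HodgeConjecture.Ring2.AbelianAll

open CategoryTheory AlgebraicGeometry
open Literature.AlgebraicGeometry Literature.AlgebraicGeometry.Motives
open Literature.AlgebraicGeometry.HodgeTheory
open Literature.AlgebraicTopology.SingularHomology (singularCohomology cupProduct cupProduct_map cupPairing cupPairing_apply)
open Summit.HodgeConjecture.HodgeConjecture.Theorems (deg_fiberGysin_aux)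

variable {𝒳 S : SchemeOver ℂ} {d : ℕ} {f : 𝒳 ⟶ S}

section Weights

/-- `𝐆[hf, s, k]` — `j_{s*} : Hᵏ(X_s(ℂ); ℂ) → H^{k+2}(𝒳(ℂ); ℂ)`, the tree's `complexGysin` of the fibre inclusion for the complex orientations
(display notation of part XXXVI-b, not a definition). [cite: FultonYoungTableaux1997, Appendix B §B.1 (5)] -/
local notation3 (prettyPrint := false) "𝐆[" hf ", " s ", " k "]" =>
  complexGysin complexOrientationFamily (IsCompactAbelianPencil.isSmoothProjective_fiberOver hf s)
    (IsCompactAbelianPencil.isSmoothProjective_total hf) (fiberι f s) (deg_fiberGysin_aux k d)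

/-! ## §1 The top degree: `H^{2d+2}(𝒳) = j_{t*} H^{2d}(X_t)` and `ν^* = N^{2d}` there -/

/-- **Every top-degree class of the total space is a Gysin image from the fibre**: `H^{2d+2}(𝒳(ℂ); ℂ)` is a line (the tree's
`exists_eq_smul_of_top`) containing the non-zero `j_{t*} j_t^* x` of part XI (`exists_fiberGysin_map_fiberι_top_ne_zero`).
[cite: HatcherAT2002, §3.3 Thm. 3.26 and Prop. 3.38] [cite: FultonYoungTableaux1997, Appendix B §B.1 (5)–(6)] -/
theorem mem_range_complexGysin_top (hf : IsCompactAbelianPencil f d) (t : ComplexPoints S) (ω : complexBetti 𝒳 (2 * d + 2)) :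
    ω ∈ LinearMap.range 𝐆[hf, t, 2 * d] := by
  obtain ⟨x, hx⟩ := exists_fiberGysin_map_fiberι_top_ne_zero hf t
  obtain ⟨c, hc⟩ := exists_eq_smul_of_top complexOrientationFamily hf.isSmoothProjective_total hx ω
  refine ⟨c • complexBetti.map (fiberι f t) (2 * d) x, ?_⟩
  rw [map_smul, hc]
  rfl

/-- **`ν^*` ACTS AS `N^{2d}` ON THE TOP DEGREE `H^{2d+2}(𝒳(ℂ); ℂ)`** for an `S`-endomorphism `ν` charted by `N · 𝟙_A` on the fibre `X_t`:
every top class is `j_{t*} x` (§1) and `ν^* j_{t*} x = N^{2d} j_{t*} x` for `x ∈ H^{2d}(X_t)` ((gysFib) from the chart, part XXVI-c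
`gysinWeight_of_chart`). Print: `θ_N` acts on `H²(S, R^{2d} f_*)` as `N^{2d}`. [cite: Kleiman1968AlgebraicCycles, §1.3 (p. 374)]
[cite: DeningerMurre1991, Thm. 3.1] [cite: MumfordAV1970, §19] -/
theorem map_top_eq_smul (hf : IsCompactAbelianPencil f d) (t : ComplexPoints S) (ν : 𝒳 ⟶ 𝒳) (hν : ν ≫ f = f) (N : ℕ)
    (hθt : ∃ (νs : fiberOver f t ⟶ fiberOver f t) (A : AbelianVariety ℂ) (e : A.X ≅ fiberOver f t),
      νs ≫ fiberι f t = fiberι f t ≫ ν ∧ e.hom ≫ νs = (N • 𝟙 A).hom.hom.hom ≫ e.hom)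
    (ω : complexBetti 𝒳 (2 * d + 2)) :
    complexBetti.map ν (2 * d + 2) ω = ((N : ℂ) ^ (2 * d)) • ω := by
  obtain ⟨y, rfl⟩ := mem_range_complexGysin_top hf t ω
  exact gysinWeight_of_chart hf t ν hν N hθt (2 * d) (2 * d + 2) (deg_fiberGysin_aux (2 * d) d) y

/-! ## §2 Weight orthogonality for the Poincaré pairing -/

/-- **`ν^*(x ∪ y) = N^{a+b} (x ∪ y)` for classes of weights `Nᵃ`, `Nᵇ`** (`ν^*` is a ring homomorphism). In particular cup product with
a class of exact weight `N²` raises weights by exactly `2`. [cite: HatcherAT2002, §3.2 Prop. 3.10] -/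
theorem map_cupProduct_of_weights (ν : 𝒳 ⟶ 𝒳) (N : ℕ) {k k' m a b : ℕ} (hkk : k + k' = m)
    {x : complexBetti 𝒳 k} {y : complexBetti 𝒳 k'} (hx : complexBetti.map ν k x = ((N : ℂ) ^ a) • x)
    (hy : complexBetti.map ν k' y = ((N : ℂ) ^ b) • y) :
    complexBetti.map ν m (cupProduct hkk x y) = ((N : ℂ) ^ (a + b)) • cupProduct hkk x y := by
  rw [cupProduct_map]
  change cupProduct hkk (complexBetti.map ν k x) (complexBetti.map ν k' y) = _
  rw [hx, hy, LinearMap.map_smul₂, map_smul, smul_smul, ← pow_add]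

/-- **WEIGHT ORTHOGONALITY.** For an `S`-endomorphism `ν` charted by `N · 𝟙_A` on the fibre `X_t` (`N ≥ 2`) and classes `y ∈ Hᵏ(𝒳)`,
`y' ∈ H^{k'}(𝒳)` of complementary degrees `k + k' = 2d + 2` with `ν^* y = Nʲ y`, `ν^* y' = N^{j'} y'` and `j + j' ≠ 2d`: **`y ∪ y' = 0`.**
Indeed `ν^*(y ∪ y') = N^{j+j'} (y ∪ y')` and `ν^*` acts as `N^{2d}` on the top degree (§1). Print: the `[×N]`-eigenspaces `Hⁱ(S, Rʲ f_*)` are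
Poincaré dual to `H^{2-i}(S, R^{2d-j} f_*)`. [cite: Kleiman1968AlgebraicCycles, §1.3 (p. 374)] [cite: DeningerMurre1991, Thm. 3.1]
[cite: HatcherAT2002, §3.3 Prop. 3.38] -/
theorem cupProduct_eq_zero_of_weights (hf : IsCompactAbelianPencil f d) (t : ComplexPoints S) (ν : 𝒳 ⟶ 𝒳) (hν : ν ≫ f = f) {N : ℕ} (hN : 2 ≤ N)
    (hθt : ∃ (νs : fiberOver f t ⟶ fiberOver f t) (A : AbelianVariety ℂ) (e : A.X ≅ fiberOver f t),
      νs ≫ fiberι f t = fiberι f t ≫ ν ∧ e.hom ≫ νs = (N • 𝟙 A).hom.hom.hom ≫ e.hom)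
    {k k' j j' : ℕ} (hkk : k + k' = 2 * d + 2) (hjj : j + j' ≠ 2 * d)
    {y : complexBetti 𝒳 k} {y' : complexBetti 𝒳 k'} (hy : complexBetti.map ν k y = ((N : ℂ) ^ j) • y)
    (hy' : complexBetti.map ν k' y' = ((N : ℂ) ^ j') • y') :
    cupProduct hkk y y' = 0 := by
  have h₁ := map_cupProduct_of_weights ν N hkk hy hy'
  have h₂ := map_top_eq_smul hf t ν hν N hθt (cupProduct hkk y y')
  rw [h₁] at h₂
  have h : ((N : ℂ) ^ (j + j') - (N : ℂ) ^ (2 * d)) • cupProduct hkk y y' = 0 := by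
    rw [sub_smul, h₂, sub_self]
  exact (smul_eq_zero.1 h).resolve_left (sub_ne_zero.2 (natCast_pow_ne_pow hN hjj))

/-- Weight orthogonality in the pairing form: `⟨y ∪ y', [𝒳(ℂ)]⟩ = 0` for weights `Nʲ`, `N^{j'}` with `j + j' ≠ 2d`.
[cite: Kleiman1968AlgebraicCycles, §1.3 (p. 374)] [cite: HatcherAT2002, §3.3 Prop. 3.38] -/
theorem cupPairing_eq_zero_of_weights (hf : IsCompactAbelianPencil f d) (t : ComplexPoints S) (ν : 𝒳 ⟶ 𝒳) (hν : ν ≫ f = f) {N : ℕ} (hN : 2 ≤ N)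
    (hθt : ∃ (νs : fiberOver f t ⟶ fiberOver f t) (A : AbelianVariety ℂ) (e : A.X ≅ fiberOver f t),
      νs ≫ fiberι f t = fiberι f t ≫ ν ∧ e.hom ≫ νs = (N • 𝟙 A).hom.hom.hom ≫ e.hom)
    {k k' j j' : ℕ} (hkk : k + k' = 2 * (d + 1)) (hjj : j + j' ≠ 2 * d)
    {y : complexBetti 𝒳 k} {y' : complexBetti 𝒳 k'} (hy : complexBetti.map ν k y = ((N : ℂ) ^ j) • y)
    (hy' : complexBetti.map ν k' y' = ((N : ℂ) ^ j') • y') :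
    cupPairing (complexOrientationFamily hf.isSmoothProjective_total) hkk y y' = 0 := by
  rw [cupPairing_apply, cupProduct_eq_zero_of_weights hf t ν hν hN hθt (by omega) hjj hy hy', map_zero, LinearMap.zero_apply]

/-- **A class of weight `Nʲ` orthogonal to the weight `N^{2d-j}` of the complementary degree is zero.** For `y ∈ H^{k+2}(𝒳)` with
`ν^* y = Nʲ y` and `k' + 2` the complementary degree (`k + k' + 4 = 2d + 2`, `k' ≤ 2d`): if `⟨y ∪ z, [𝒳]⟩ = 0` for every `z ∈ H^{k'+2}(𝒳)` of
weight `N^{2d-j}` (`j ≤ 2d`), then `y = 0` — every `z` splits into its three weights (part XXXVI-b), the two of weight `≠ N^{2d-j}` pair to zero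
with `y` (§2), and the Poincaré pairing is perfect (the tree's `eq_zero_of_forall_cupPairing_eq_zero`). [cite: HatcherAT2002, §3.3 Prop. 3.38]
[cite: DeningerMurre1991, Thm. 3.1] -/
theorem eq_zero_of_weight_of_forall (hf : IsCompactAbelianPencil f d) (t : ComplexPoints S) (ν : 𝒳 ⟶ 𝒳) (hν : ν ≫ f = f) {N : ℕ} (hN : 2 ≤ N)
    (hθ : ∀ s : ComplexPoints S, ∃ (νs : fiberOver f s ⟶ fiberOver f s) (A : AbelianVariety ℂ) (e : A.X ≅ fiberOver f s),
      νs ≫ fiberι f s = fiberι f s ≫ ν ∧ e.hom ≫ νs = (N • 𝟙 A).hom.hom.hom ≫ e.hom)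
    {k k' j : ℕ} (hkk : k + 2 + (k' + 2) = 2 * (d + 1)) (hk' : k' ≤ 2 * d) (hj : j ≤ 2 * d)
    {y : complexBetti 𝒳 (k + 2)} (hy : complexBetti.map ν (k + 2) y = ((N : ℂ) ^ j) • y)
    (horth : ∀ z : complexBetti 𝒳 (k' + 2), complexBetti.map ν (k' + 2) z = ((N : ℂ) ^ (2 * d - j)) • z →
      cupPairing (complexOrientationFamily hf.isSmoothProjective_total) hkk y z = 0) :
    y = 0 := by
  refine eq_zero_of_forall_cupPairing_eq_zero complexOrientationFamily hf.isSmoothProjective_total hkk fun z ↦ ?_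
  obtain ⟨e₀, e₁, e₂, -, -, hsum, hwt, -⟩ := exists_leraySplitting hf t ν hν hN hθ hk'
  obtain ⟨h₀, h₁, h₂⟩ := hwt z
  -- a component either has the dual weight (then `horth`) or pairs to zero with `y` (§2)
  have hcomp : ∀ (m : ℕ) (w : complexBetti 𝒳 (k' + 2)), complexBetti.map ν (k' + 2) w = ((N : ℂ) ^ m) • w →
      cupPairing (complexOrientationFamily hf.isSmoothProjective_total) hkk y w = 0 := by
    intro m w hw
    by_cases hm : j + m = 2 * d
    · have hm' : m = 2 * d - j := by omega
      subst hm'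
      exact horth w hw
    · exact cupPairing_eq_zero_of_weights hf t ν hν hN (hθ t) hkk hm hy hw
  rw [← hsum z, map_add, map_add, hcomp _ _ h₀, hcomp _ _ h₁, hcomp _ _ h₂, add_zero, add_zero]

/-! ## §3 An algebraic polarisation of exact top weight -/

/-- **AN ALGEBRAIC, RATIONAL POLARISATION OF EXACT TOP WEIGHT.** For a compact pencil of abelian `d`-folds with an `S`-endomorphism `ν`
charted by `N · 𝟙_A` on every fibre (`N ≥ 2`) there is `η₀ ∈ H²(𝒳(ℂ); ℂ)` with: `η₀ ∈ N¹H²(𝒳)` (algebraic), `η₀` rational,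
**`ν^* η₀ = N² · η₀`**, and `j_s^* η₀` a polarisation class of EVERY fibre `X_s` (indeed `j_s^* η₀ = j_s^* K` for the global algebraic
polarisation `K` of part XII). Construction: `η₀ = e₀ K` for the top Leray idempotent `e₀` of part XXXVI-b at `t` (algebraic and rational, so is
`e₀ K`; `j_t^*(e₀ K − K) = 0`, and a class dying on one fibre dies on all, part X-c). Print: replace an ample class by its component in
`H⁰(S, R² f_*)` under the `[×N]`-splitting. [cite: DeningerMurre1991, Thm. 3.1] [cite: Kunnemann1993, Thm. 3.1 and §2]
[cite: VoisinHodgeII2003, §9.2.4 Prop. 9.21] -/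
theorem exists_topWeight_polarization (hf : IsCompactAbelianPencil f d) (t : ComplexPoints S) (ν : 𝒳 ⟶ 𝒳) (hν : ν ≫ f = f) {N : ℕ} (hN : 2 ≤ N)
    (hθ : ∀ s : ComplexPoints S, ∃ (νs : fiberOver f s ⟶ fiberOver f s) (A : AbelianVariety ℂ) (e : A.X ≅ fiberOver f s),
      νs ≫ fiberι f s = fiberι f s ≫ ν ∧ e.hom ≫ νs = (N • 𝟙 A).hom.hom.hom ≫ e.hom) :
    ∃ η₀ : complexBetti 𝒳 2, η₀ ∈ algebraicClasses 𝒳 1 ∧ IsRationalClass η₀ ∧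
      complexBetti.map ν 2 η₀ = ((N : ℂ) ^ 2) • η₀ ∧
      (∃ K : complexBetti 𝒳 2, K ∈ algebraicClasses 𝒳 1 ∧ IsRationalClass K ∧
        (∀ s : ComplexPoints S, IsPolarizationClass d (fiberOver f s) (complexBetti.map (fiberι f s) 2 K)) ∧
        ∀ s : ComplexPoints S, complexBetti.map (fiberι f s) 2 η₀ = complexBetti.map (fiberι f s) 2 K) ∧
      ∀ s : ComplexPoints S, IsPolarizationClass d (fiberOver f s) (complexBetti.map (fiberι f s) 2 η₀) := by
  obtain ⟨K, hKalg, hKrat, hKs⟩ := exists_algebraic_globalPolarization hf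
  obtain ⟨e₀, e₁, e₂, ⟨alg₀, -, -⟩, hrat, -, hwt, hidem, -, hfib, -, -, hfix⟩ :=
    exists_leraySplitting hf t ν hν hN hθ (k := 0) (Nat.zero_le _)
  have hK2 : complexBetti.map (fiberι f t) (0 + 2) (e₀ K) = complexBetti.map (fiberι f t) (0 + 2) K := (hfib K).1
  -- the defect dies on `X_t`, hence on every fibre
  have hdef : ∀ s : ComplexPoints S, complexBetti.map (fiberι f s) 2 (e₀ K) = complexBetti.map (fiberι f s) 2 K := by
    intro s
    have h0 : complexBetti.map (fiberι f t) 2 (e₀ K - K) = 0 := by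
      rw [map_sub, sub_eq_zero]
      exact hK2
    have hs := map_fiberι_eq_zero_of_eq_zero hf h0 s
    rwa [map_sub, sub_eq_zero] at hs
  have halg : e₀ K ∈ algebraicClasses 𝒳 1 :=
    map_mem_algebraicClasses_of_isAlgebraicCorrespondence hf.isSmoothProjective_total hf.isSmoothProjective_total
      (p := 1) (q := 1) alg₀ hKalg
  refine ⟨e₀ K, halg, (hrat K hKrat).1, ?_, ⟨K, hKalg, hKrat, hKs, hdef⟩, fun s ↦ ?_⟩
  · exact ((hfix (e₀ K)).1).1 (hidem K).1
  · rw [hdef s]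
    exact hKs s

end Weights

end Summit.HodgeConjecture.HodgeConjecture.Ring2.AbelianAll

end
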